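import Summits.Langlands.Langlands.Theses.PhantomRMYoshida
import Summits.Langlands.Langlands.Theorems.PhantomRMYoshidaFaltingsTateModuleQGate
import Summits.Langlands.Langlands.Theorems.PhantomRMYoshidaFaltingsFinitenessIOfIsogenyBound
import Summits.Langlands.Langlands.Theorems.PhantomRMYoshidaFaltingsFinitenessIKernelBoundConverse
import Literature.NumberTheory.DiophantineGeometry.MasserWustholzIsogenyTheorem

/-!
# Route PhantomRMYoshida — `FaltingsTateModuleQ` (item stmt-Langlands-15085) from the isogeny-kernel bound over `ℚ`

The gate `FaltingsTateModuleQ` (Faltings, *Endlichkeitssätze für abelsche Varietäten über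
Zahlkörpern*, Invent. Math. 73 (1983), §5: Satz 4 in `End` form — bijectivity of
`ℤ_p ⊗_ℤ End_ℚ(B) → End_{Γ_ℚ}(T_p B)` — and Satz 3 — semisimplicity of `V_p B`, for every prime
`p` and every abelian variety `B/ℚ`) is held behind the gate `FaltingsFinitenessI` (item
stmt-Langlands-15084), from which it follows by name (`faltingsTateModuleQ_of_finitenessI`,
`Theorems/PhantomRMYoshidaFaltingsTateModuleQGate.lean`).

Since the picked line `Sketch` of crux stmt-Langlands-15084 landed its counting reduction
(`faltingsFinitenessI_of_isogenyKernelBound`, `Theorems/PhantomRMYoshidaFaltingsFinitenessIOfIsogenyBound.lean`: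
bound the degree of a connecting isogeny, then count geometric kernels inside `A[N!](ℚ̄)`), the
one open registered stub upstream is K1 `stub_isogenyKernelBound` — the qualitative
Masser–Wüstholz isogeny theorem at `K = ℚ` in its `∃ g` form (D. Masser, G. Wüstholz, *Isogeny
estimates for abelian varieties, and finiteness theorems*, Ann. of Math. 137 (1993), and
*Factorization estimates for abelian varieties*, Publ. Math. IHÉS 81 (1995), Thm. II; the `∀ g`
form is refuted in the tree, `Theorems/FaltingsFinitenessI/Negative/NotIsogenyKernelBoundForall.lean`).

This file records, by name and against the route decl, that **the item is a consequence of K1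
alone**: `faltingsTateModuleQ_of_isogenyKernelBound`, whose hypothesis is K1's registered
signature verbatim. So whatever discharges K1 closes item stmt-Langlands-15085 in one line,
independently of the bookkeeping of item stmt-Langlands-15084. Pure-proof file (composition of two
landed theorems); no definition, no named fact.
-/

set_option linter.dupNamespace false -- as in the sibling Theorems files: `Summit.Langlands.Langlands` is the mandated namespace (summit = sub-problem)

namespace Summit.Langlands.Langlands.Theorems.PhantomRMYoshida

open CategoryTheory
open Summit.Langlands.Langlands.Theses.PhantomRMYoshida
open Literature.AlgebraicGeometry.Motives
open Literature.AlgebraicGeometry.Motives.AbelianVariety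

/-- **`FaltingsTateModuleQ` from the isogeny-kernel bound over `ℚ` (K1).** If for every abelian
variety `A/ℚ` there is `N` such that every `B/ℚ` admitting an isogeny `B → A` is the target of an
isogeny `g : A → B` of degree `Hom.kerRank g ≤ N` (Masser–Wüstholz, Ann. of Math. 137 (1993) /
Publ. Math. IHÉS 81 (1995), Thm. II, qualitative form at `K = ℚ`; verbatim the registered stub
`stub_isogenyKernelBound` of line `Sketch` of crux stmt-Langlands-15084), then Faltings'
Tate-module theorems over `ℚ` hold (route decl `FaltingsTateModuleQ`: Faltings 1983, §5, Satz 4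
in `End` form and Satz 3). Proof: K1 gives Finiteness I over `ℚ` by counting geometric kernels
(`faltingsFinitenessI_of_isogenyKernelBound`), and Finiteness I gives the gate
(`faltingsTateModuleQ_of_finitenessI`: Tate's lattice argument, quotient isogenies, Mumford §19
Thm. 3, Poincaré reducibility with Galois descent — all theorems of the tree). -/
theorem faltingsTateModuleQ_of_isogenyKernelBound
    (hK1 : ∀ A : AbelianVariety ℚ, ∃ N : ℕ, ∀ B : AbelianVariety ℚ, IsIsogenous B A →
      ∃ g : A ⟶ B, IsIsogeny g ∧ Hom.kerRank g ≤ N) :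
    FaltingsTateModuleQ :=
  faltingsTateModuleQ_of_finitenessI (faltingsFinitenessI_of_isogenyKernelBound hK1)

/-- **Uniform variant.** The same conclusion from a kernel bound `N` chosen per `A` as a function
(`N : AbelianVariety ℚ → ℕ`), the shape in which an effective Masser–Wüstholz bound
`N(A) = c(dim A) · max(1, h_F(A))^κ` would be supplied; immediate from
`faltingsTateModuleQ_of_isogenyKernelBound`. -/
theorem faltingsTateModuleQ_of_isogenyKernelBound_fun (N : AbelianVariety ℚ → ℕ)
    (hN : ∀ A B : AbelianVariety ℚ, IsIsogenous B A →
      ∃ g : A ⟶ B, IsIsogeny g ∧ Hom.kerRank g ≤ N A) :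
    FaltingsTateModuleQ :=
  faltingsTateModuleQ_of_isogenyKernelBound fun A => ⟨N A, fun B hB => hN A B hB⟩

/-- **`FaltingsTateModuleQ` from the Masser–Wüstholz isogeny theorem, BY NAME** (closed modulo the
Literature named fact). If the qualitative Masser–Wüstholz isogeny theorem
`Literature.NumberTheory.DiophantineGeometry.exists_isogeny_kerRank_le_of_isIsogenous A`
(Masser–Wüstholz, *Factorization estimates for abelian varieties*, Publ. Math. IHÉS 81 (1995),
Theorem II, p. 6, rational case; a cite-only `def … : Prop` of the tree, no `_holds`) holds for every
abelian variety `A/ℚ`, then Faltings' Tate-module theorems over `ℚ` hold (route decl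
`FaltingsTateModuleQ`: Faltings 1983, §5, Satz 4 in `End` form and Satz 3). The fact's
`∀ [NumberField ℚ]` binder is discharged by `Rat.numberField`, after which its body is K1 verbatim
(`faltingsTateModuleQ_of_isogenyKernelBound`). This is the item's second one-fact closer beside
`faltingsTateModuleQ_of_forall_finite_isoClasses_isogenous` (Finiteness I, the heights road); the
two named facts are equivalent in strength over `ℚ` (`isogenyKernelBound_of_faltingsFinitenessI` /
`faltingsFinitenessI_of_isogenyKernelBound`). CONDITIONAL: credits nothing until a discharge
`exists_isogeny_kerRank_le_of_isIsogenous_holds` exists. -/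
theorem faltingsTateModuleQ_of_masserWustholz
    (hMW : ∀ A : AbelianVariety ℚ,
      Literature.NumberTheory.DiophantineGeometry.exists_isogeny_kerRank_le_of_isIsogenous A) :
    FaltingsTateModuleQ :=
  faltingsTateModuleQ_of_isogenyKernelBound fun A => hMW A

/-- **The gate's outstanding input, stated as an equivalence of hypotheses over `ℚ`.** The two
one-fact hypotheses from which this item is closed in the tree — Finiteness I for every `A/ℚ`
(`AbelianVariety.finite_isoClasses_isogenous`, Faltings 1983, §6) and the qualitative
Masser–Wüstholz bound for every `A/ℚ` (`exists_isogeny_kerRank_le_of_isIsogenous`, Publ. Math.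
IHÉS 81 (1995), Thm. II) — are equivalent, both being equivalent to the route decl
`FaltingsFinitenessI` (`faltingsFinitenessI_iff`; `isogenyKernelBound_of_faltingsFinitenessI` and
`faltingsFinitenessI_of_isogenyKernelBound`). So discharging EITHER named fact closes item
stmt-Langlands-15085 (by `faltingsTateModuleQ_of_forall_finite_isoClasses_isogenous`, resp.
`faltingsTateModuleQ_of_masserWustholz`). -/
theorem forall_finite_isoClasses_isogenous_iff_forall_masserWustholz :
    (∀ A : AbelianVariety ℚ, finite_isoClasses_isogenous A) ↔
      ∀ A : AbelianVariety ℚ,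
        Literature.NumberTheory.DiophantineGeometry.exists_isogeny_kerRank_le_of_isIsogenous A := by
  constructor
  · intro hfin A _
    exact isogenyKernelBound_of_faltingsFinitenessI (fun P => hfin P) A
  · intro hMW A _
    exact faltingsFinitenessI_of_isogenyKernelBound (fun P => hMW P) A

end Summit.Langlands.Langlands.Theorems.PhantomRMYoshida
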